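import Literature.Combinatorics.StablePolynomials.BasicProofs
import Literature.Combinatorics.StablePolynomials.RealStableMultiaffineCriterion
import HarnessLib

/-!
# Partial symmetrization preserves stability of multi-affine polynomials (Borcea–Brändén–Liggett, Thm. 4.20)

Borcea–Brändén–Liggett, *Negative dependence and the geometry of polynomials*, J. Amer. Math. Soc. 22 (2009)
(arXiv:0707.2340), §4.3:

> **Theorem 4.20.** Let `μ` be a complex measure on `2^{[n]}` with (complex) stable generating polynomial. Then for
> any transposition `τ ∈ 𝔖_n` and `θ ∈ [0,1]` the generating polynomial of the partial symmetrization
> `μ^{τ,θ} = θμ + (1 - θ)τ(μ)` is (complex) stable. In particular, […] the class of strongly Rayleigh measures on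
> `2^{[n]}` is invariant under the partial symmetrization procedure.

In polynomial terms (proof of Thm. 4.20, p. 19: "we need to prove that
`θ f(ξ_1, ξ_2, …, ξ_n) + (1 - θ) f(ξ_2, ξ_1, …, ξ_n) ≠ 0` whenever `ξ_1, …, ξ_n ∈ {z : Im(z) > 0}`"): for a stable
multi-affine `f ∈ ℂ[z_1, …, z_n]`, a transposition `τ = (a b)` and `θ ∈ [0, 1]`, the polynomial
`T_θ(f) = θ f + (1 - θ) f ∘ τ` is stable (`IsUpperHalfPlaneStable.partialSymmetrization`). This is the fact quoted by
Brändén–Huh (*Lorentzian polynomials*, §3.1 before Cor. 3.9 and §4.5 Prop. 4.23): "if `f = f(w_1, w_2, …, w_n)` is a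
stable multi-affine polynomial with nonnegative coefficients, then the multi-affine polynomial
`Φ^{1,2}_θ(f) = (1 - θ) f(w_1, w_2, w_3, …, w_n) + θ f(w_2, w_1, w_3, …, w_n)` is stable for all `0 ≤ θ ≤ 1`"
(`IsRealStable.symmExclusion`; no sign condition is needed).

## The proof

The printed proof goes through the multivariate Obreschkoff theorem (Thm. 4.21, not in the tree); Remark 4.4 of
loc. cit. records that "there are now elementary proofs of Theorem 4.20 that avoid the multivariate Obreschkoff
theorem, see [BB, L3]". The proof here is elementary in that sense and uses two theorems of the tree:

1. **Borcea–Brändén's symbol criterion** (Invent. Math. 177 (2009), Lemma 2.2 / Thm. 1.1 for multi-affine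
   polynomials; tree `multiAffine_stabilityPreserver_sufficiency`): a linear operator `T` maps stable multi-affine
   polynomials to stable-or-zero ones as soon as its symbol `G_T(z, w) = T[Π_i (z_i + w_i)]` is stable. For
   `T_θ = θ·id + (1 - θ)·(∘τ)` the symbol is
   `Π_{i ≠ a, b} (z_i + w_i) · [θ (z_a + w_a)(z_b + w_b) + (1 - θ)(z_b + w_a)(z_a + w_b)]`.
2. **Brändén's Rayleigh criterion** (Adv. Math. 216 (2007), Thm. 5.6; tree
   `eq_zero_or_isRealStable_of_rayleighDiff_nonneg`) for the real multi-affine kernel in four variables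
   `s_θ = θ (x_0 + x_2)(x_1 + x_3) + (1 - θ)(x_0 + x_3)(x_1 + x_2)`: its Rayleigh differences are
   `Δ_{01} = θ(1-θ)(x_2 - x_3)²`, `Δ_{23} = θ(1-θ)(x_0 - x_1)²`, `Δ_{02} = θ(x_1 + x_3)²`, `Δ_{13} = θ(x_0 + x_2)²`,
   `Δ_{03} = (1-θ)(x_1 + x_2)²`, `Δ_{12} = (1-θ)(x_0 + x_3)²`, `Δ_{ii} = (∂_i s_θ)²`, all `≥ 0` for `θ ∈ [0,1]`, so
   `s_θ` is real stable (this is where `0 ≤ θ ≤ 1` enters, exactly as `D_{T_θ(f)} = D_f - θ(1-θ)(a_{01} - a_{10})²`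
   in the printed proof).

Finally `T_θ(f) ≠ 0`: on the diagonal `z_a = z_b` one has `T_θ(f) = f ≠ 0`.

## Main results (namespace `Literature.Combinatorics.StablePolynomials`)

* `symKernel θ`, `isRealStable_symKernel` — the four-variable kernel and its stability for `θ ∈ [0,1]`.
* `partialSymmetrization θ τ` — the operator `T_θ = θ·id + (1 - θ)·rename τ` (a `ℂ`-linear map), its symbol
  `isUpperHalfPlaneStable_multiAffineSymbol_partialSymmetrization`.
* `IsUpperHalfPlaneStable.partialSymmetrization` — **Thm. 4.20** (complex stable multi-affine `f`).
* `IsRealStable.partialSymmetrization`, `IsRealStable.symmExclusion` — real forms (Brändén–Huh's `Φ^{a,b}_θ`).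

## References

* J. Borcea, P. Brändén, T. M. Liggett, *Negative dependence and the geometry of polynomials*, J. Amer. Math. Soc.
  22 (2009) 521–567; arXiv:0707.2340, §4.3 Thm. 4.20, Remark 4.4; §5 Prop. 5.1. [BorceaBrandenLiggett2007]
* J. Borcea, P. Brändén, *The Lee–Yang and Pólya–Schur programs. I*, Invent. Math. 177 (2009), Thm. 1.1,
  Lemma 2.2. [BorceaBranden2009]
* P. Brändén, *Polynomials with the half-plane property and matroid theory*, Adv. Math. 216 (2007), Thm. 5.6.
  [Branden2007]
* P. Brändén, J. Huh, *Lorentzian polynomials*, Ann. of Math. 192 (2020); arXiv:1902.03719v4, §3.1 (before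
  Cor. 3.9). [BrandenHuh2019]
-/

noncomputable section

open MvPolynomial Finset

namespace Literature.Combinatorics.StablePolynomials

/-! ## §1 The four-variable kernel `s_θ = θ (x₀ + x₂)(x₁ + x₃) + (1 - θ)(x₀ + x₃)(x₁ + x₂)` -/

section Kernel

/-- **The kernel of the symbol of `T_θ`**: `s_θ(x₀, x₁, x₂, x₃) = θ (x₀ + x₂)(x₁ + x₃) + (1 - θ)(x₀ + x₃)(x₁ + x₂)`
(`x₀, x₁ = z_a, z_b`, `x₂, x₃ = w_a, w_b` in the symbol `T_θ[Π (z_i + w_i)]`).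
[cite: BorceaBrandenLiggett2007, §4.3 proof of Thm. 4.20 (the operator `T_θ`)] [cite: BorceaBranden2009, §2.1
Lemma 2.2 (the symbol `G_T`)] -/
def symKernel (θ : ℝ) : MvPolynomial (Fin 4) ℝ :=
  C θ * ((X 0 + X 2) * (X 1 + X 3)) + C (1 - θ) * ((X 0 + X 3) * (X 1 + X 2))

/-- `s_θ` unfolded. [cite: BorceaBrandenLiggett2007, §4.3 proof of Thm. 4.20] -/
theorem symKernel_def (θ : ℝ) :
    symKernel θ = C θ * ((X 0 + X 2) * (X 1 + X 3)) + C (1 - θ) * ((X 0 + X 3) * (X 1 + X 2)) := rfl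

/-- `x_a + x_c` has degree `≤ 1` in every variable. [folklore] -/
private theorem degreeOf_X_add_X_le (k a c : Fin 4) : degreeOf k (X a + X c : MvPolynomial (Fin 4) ℝ) ≤ 1 := by
  refine (degreeOf_add_le _ _ _).trans (max_le ?_ ?_) <;> rw [degreeOf_X] <;> split_ifs <;> simp

/-- `x_a + x_c` has degree `0` in a third variable. [folklore] -/
private theorem degreeOf_X_add_X_eq_zero {k a c : Fin 4} (ha : k ≠ a) (hc : k ≠ c) :
    degreeOf k (X a + X c : MvPolynomial (Fin 4) ℝ) = 0 := by
  refine Nat.eq_zero_of_le_zero ((degreeOf_add_le _ _ _).trans (max_le ?_ ?_)) <;>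
    rw [degreeOf_X] <;> simp [ha, hc]

/-- A product of two linear forms in disjoint variables has degree `≤ 1` in every variable. [folklore] -/
private theorem degreeOf_mul_linear_le {k a b c d : Fin 4} (h : (k ≠ a ∧ k ≠ c) ∨ (k ≠ b ∧ k ≠ d)) :
    degreeOf k ((X a + X c) * (X b + X d) : MvPolynomial (Fin 4) ℝ) ≤ 1 := by
  refine (degreeOf_mul_le _ _ _).trans ?_
  rcases h with ⟨ha, hc⟩ | ⟨hb, hd⟩
  · rw [degreeOf_X_add_X_eq_zero ha hc, zero_add]
    exact degreeOf_X_add_X_le _ _ _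
  · rw [degreeOf_X_add_X_eq_zero hb hd, add_zero]
    exact degreeOf_X_add_X_le _ _ _

/-- **`s_θ` is multi-affine.** [cite: BorceaBrandenLiggett2007, §4.3 proof of Thm. 4.20] -/
theorem isMultiAffine_symKernel (θ : ℝ) : IsMultiAffine (symKernel θ) := by
  intro k
  rw [symKernel]
  refine (degreeOf_add_le _ _ _).trans (max_le ?_ ?_) <;> refine (degreeOf_C_mul_le _ _ _).trans ?_
  · fin_cases k <;> exact degreeOf_mul_linear_le (by decide)
  · fin_cases k <;> exact degreeOf_mul_linear_le (by decide)

/-- `s_θ(1,1,1,1) = 4`, so `s_θ ≠ 0`. [cite: BorceaBrandenLiggett2007, §4.3 proof of Thm. 4.20] -/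
theorem symKernel_ne_zero (θ : ℝ) : symKernel θ ≠ 0 := by
  intro h
  have h1 : eval (fun _ => (1 : ℝ)) (symKernel θ) = 4 := by
    simp only [symKernel, map_add, map_mul, eval_C, eval_X]
    ring
  rw [h, map_zero] at h1
  norm_num at h1

/-- **The Rayleigh differences of `s_θ` are nonnegative on `ℝ⁴` for `θ ∈ [0,1]`**:
`Δ₀₁ = θ(1-θ)(x₂-x₃)²`, `Δ₂₃ = θ(1-θ)(x₀-x₁)²`, `Δ₀₂ = θ(x₁+x₃)²`, `Δ₁₃ = θ(x₀+x₂)²`, `Δ₀₃ = (1-θ)(x₁+x₂)²`,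
`Δ₁₂ = (1-θ)(x₀+x₃)²`, `Δᵢᵢ = (∂ᵢ s_θ)²` (the analogue of "`D_{T_θ(f)} = D_f - θ(1-θ)(a₀₁ - a₁₀)²`").
[cite: BorceaBrandenLiggett2007, §4.3 proof of Thm. 4.20] [cite: Branden2007, §5 Thm. 5.6] -/
theorem rayleighDiff_symKernel_nonneg {θ : ℝ} (h0 : 0 ≤ θ) (h1 : θ ≤ 1) (x : Fin 4 → ℝ) (i j : Fin 4) :
    0 ≤ eval x (rayleighDiff i j (symKernel θ)) := by
  have h1' : 0 ≤ 1 - θ := sub_nonneg.2 h1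
  have hθθ : 0 ≤ θ * (1 - θ) := mul_nonneg h0 h1'
  rw [rayleighDiff]
  fin_cases i <;> fin_cases j <;>
    simp [symKernel, pderiv_X]
  · nlinarith [sq_nonneg (θ * (x 1 + x 3) + (1 - θ) * (x 1 + x 2))]
  · nlinarith [mul_nonneg hθθ (sq_nonneg (x 2 - x 3))]
  · nlinarith [mul_nonneg h0 (sq_nonneg (x 1 + x 3))]
  · nlinarith [mul_nonneg h1' (sq_nonneg (x 1 + x 2))]
  · nlinarith [mul_nonneg hθθ (sq_nonneg (x 2 - x 3))]
  · nlinarith [sq_nonneg (θ * (x 0 + x 2) + (1 - θ) * (x 0 + x 3))]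
  · nlinarith [mul_nonneg h1' (sq_nonneg (x 0 + x 3))]
  · nlinarith [mul_nonneg h0 (sq_nonneg (x 0 + x 2))]
  · nlinarith [mul_nonneg h0 (sq_nonneg (x 1 + x 3))]
  · nlinarith [mul_nonneg h1' (sq_nonneg (x 0 + x 3))]
  · nlinarith [sq_nonneg (θ * (x 1 + x 3) + (1 - θ) * (x 0 + x 3))]
  · nlinarith [mul_nonneg hθθ (sq_nonneg (x 0 - x 1))]
  · nlinarith [mul_nonneg h1' (sq_nonneg (x 1 + x 2))]
  · nlinarith [mul_nonneg h0 (sq_nonneg (x 0 + x 2))]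
  · nlinarith [mul_nonneg hθθ (sq_nonneg (x 0 - x 1))]
  · nlinarith [sq_nonneg (θ * (x 0 + x 2) + (1 - θ) * (x 1 + x 2))]

/-- **`s_θ` is real stable for `θ ∈ [0,1]`** (Brändén's criterion, Thm. 5.6). [cite: BorceaBrandenLiggett2007, §4.3
proof of Thm. 4.20 ("`T_θ(f)` is also real stable")] [cite: Branden2007, §5 Thm. 5.6] -/
theorem isRealStable_symKernel {θ : ℝ} (h0 : 0 ≤ θ) (h1 : θ ≤ 1) : IsRealStable (symKernel θ) :=
  (eq_zero_or_isRealStable_of_rayleighDiff_nonneg (Fin 4) (symKernel θ) (isMultiAffine_symKernel θ)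
    (rayleighDiff_symKernel_nonneg h0 h1)).resolve_left (symKernel_ne_zero θ)

/-- **The kernel does not vanish on `H⁴`**: `θ (z_a + w_a)(z_b + w_b) + (1 - θ)(z_b + w_a)(z_a + w_b) ≠ 0` for
`z_a, z_b, w_a, w_b` in the open upper half-plane and `θ ∈ [0,1]`. [cite: BorceaBrandenLiggett2007, §4.3 proof of
Thm. 4.20] -/
theorem symKernel_eval_ne_zero {θ : ℝ} (h0 : 0 ≤ θ) (h1 : θ ≤ 1) {za zb wa wb : ℂ} (hza : 0 < za.im)
    (hzb : 0 < zb.im) (hwa : 0 < wa.im) (hwb : 0 < wb.im) :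
    (θ : ℂ) * ((za + wa) * (zb + wb)) + (1 - (θ : ℂ)) * ((zb + wa) * (za + wb)) ≠ 0 := by
  have h := isRealStable_symKernel h0 h1 ![za, zb, wa, wb] fun i => by
    fin_cases i <;> assumption
  have hev : eval ![za, zb, wa, wb] (map (algebraMap ℝ ℂ) (symKernel θ)) =
      (θ : ℂ) * ((za + wa) * (zb + wb)) + (1 - (θ : ℂ)) * ((zb + wa) * (za + wb)) := by
    simp only [symKernel, map_add, map_mul, map_C, map_X, eval_C, eval_X, Complex.coe_algebraMap, map_sub,
      map_one]
    simp only [Matrix.cons_val_zero, Matrix.cons_val_one, Matrix.cons_val]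
    ring
  rwa [hev] at h

end Kernel

/-! ## §2 The operator `T_θ = θ·id + (1 - θ)·(∘ τ)` and its symbol -/

section Operator

variable {σ : Type*}

/-- **Partial symmetrization** `T_θ(f) = θ f + (1 - θ) f ∘ τ` for a permutation `τ` of the variables (Borcea–Brändén–
Liggett: the generating polynomial of `μ^{τ,θ} = θμ + (1 - θ)τ(μ)`; "`T_θ(h)(z_1, z_2) = θ h(z_1, z_2) +
(1 - θ) h(z_2, z_1)`"), as a `ℂ`-linear operator (`f ∘ τ = rename τ f`). [cite: BorceaBrandenLiggett2007, §4.3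
Thm. 4.20 and its proof (the operator `T_θ`)] -/
def partialSymmetrization (θ : ℂ) (τ : Equiv.Perm σ) : MvPolynomial σ ℂ →ₗ[ℂ] MvPolynomial σ ℂ :=
  θ • LinearMap.id + (1 - θ) • (rename τ : MvPolynomial σ ℂ →ₐ[ℂ] MvPolynomial σ ℂ).toLinearMap

/-- `T_θ(f) = θ f + (1 - θ) f ∘ τ`. [cite: BorceaBrandenLiggett2007, §4.3 proof of Thm. 4.20] -/
theorem partialSymmetrization_apply (θ : ℂ) (τ : Equiv.Perm σ) (f : MvPolynomial σ ℂ) :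
    partialSymmetrization θ τ f = θ • f + (1 - θ) • rename τ f := rfl

variable [Fintype σ] [DecidableEq σ]

/-- **The symbol of `T_θ` for a transposition `τ = (a b)` is stable** (`θ ∈ [0,1]`):
`G_{T_θ}(z, w) = T_θ[Π_i (z_i + w_i)] = Π_{i ≠ a,b} (z_i + w_i) · s_θ(z_a, z_b, w_a, w_b)`.
[cite: BorceaBranden2009, §2.1 Lemma 2.2] [cite: BorceaBrandenLiggett2007, §4.3 Thm. 4.20] -/
theorem isUpperHalfPlaneStable_multiAffineSymbol_partialSymmetrization {θ : ℝ} (h0 : 0 ≤ θ) (h1 : θ ≤ 1)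
    (a b : σ) : IsUpperHalfPlaneStable (multiAffineSymbol (partialSymmetrization (θ : ℂ) (Equiv.swap a b))) := by
  intro zw hzw
  rw [← Sum.elim_comp_inl_inr zw, eval_multiAffineSymbol]
  set z : σ → ℂ := zw ∘ Sum.inl with hz
  set w : σ → ℂ := zw ∘ Sum.inr with hw
  have hzi : ∀ i, 0 < (z i).im := fun i => hzw _
  have hwi : ∀ i, 0 < (w i).im := fun i => hzw _
  -- `T_θ[Π (X_i + w_i)](z) = θ Π (z_i + w_i) + (1 - θ) Π (z_{τ i} + w_i)`
  have hT : eval z (partialSymmetrization (θ : ℂ) (Equiv.swap a b) (∏ i, (X i + C (w i)))) =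
      (θ : ℂ) * ∏ i, (z i + w i) + (1 - (θ : ℂ)) * ∏ i, (z (Equiv.swap a b i) + w i) := by
    rw [partialSymmetrization_apply, map_add, smul_eval, smul_eval, map_prod, map_prod, map_prod]
    simp only [map_add, eval_X, eval_C, rename_X, rename_C]
  rw [hT]
  -- the factors `z_i + w_i` lie in `H`, in particular they are nonzero
  have hne : ∀ i j, z i + w j ≠ 0 := fun i j h => by
    have := congrArg Complex.im h
    rw [Complex.add_im, Complex.zero_im] at this
    linarith [hzi i, hwi j]
  by_cases hab : a = b
  · subst hab
    rw [Equiv.swap_self]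
    simp only [Equiv.refl_apply]
    rw [← add_mul, add_sub_cancel, one_mul]
    exact Finset.prod_ne_zero_iff.2 fun i _ => hne i i
  -- split off the factors `i = a` and `i = b`
  have hsplit : ∀ g : σ → ℂ, ∏ i, g i = g a * (g b * ∏ i ∈ (Finset.univ.erase a).erase b, g i) := by
    intro g
    rw [← Finset.mul_prod_erase _ _ (Finset.mem_univ a),
      ← Finset.mul_prod_erase _ _ (Finset.mem_erase.2 ⟨Ne.symm hab, Finset.mem_univ b⟩)]
  have hrest : ∏ i ∈ (Finset.univ.erase a).erase b, (z (Equiv.swap a b i) + w i) =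
      ∏ i ∈ (Finset.univ.erase a).erase b, (z i + w i) := by
    refine Finset.prod_congr rfl fun i hi => ?_
    have hib : i ≠ b := Finset.ne_of_mem_erase hi
    have hia : i ≠ a := Finset.ne_of_mem_erase (Finset.mem_of_mem_erase hi)
    rw [Equiv.swap_apply_of_ne_of_ne hia hib]
  rw [hsplit (fun i => z i + w i), hsplit (fun i => z (Equiv.swap a b i) + w i), hrest]
  simp only [Equiv.swap_apply_left, Equiv.swap_apply_right]
  set P := ∏ i ∈ (Finset.univ.erase a).erase b, (z i + w i) with hP
  have hP0 : P ≠ 0 := Finset.prod_ne_zero_iff.2 fun i _ => hne i i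
  have hfac : (θ : ℂ) * ((z a + w a) * ((z b + w b) * P)) + (1 - (θ : ℂ)) * ((z b + w a) * ((z a + w b) * P)) =
      P * ((θ : ℂ) * ((z a + w a) * (z b + w b)) + (1 - (θ : ℂ)) * ((z b + w a) * (z a + w b))) := by
    ring
  rw [hfac]
  exact mul_ne_zero hP0 (symKernel_eval_ne_zero h0 h1 (hzi a) (hzi b) (hwi a) (hwi b))

end Operator

/-! ## §3 Theorem 4.20 -/

section Main

variable {σ : Type*} [Fintype σ] [DecidableEq σ]

omit [Fintype σ] in
/-- On the diagonal `z_a = z_b`, `f ∘ (a b) = f`. [folklore] -/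
private theorem eval_rename_swap_of_eq {R : Type*} [CommSemiring R] (f : MvPolynomial σ R) {a b : σ}
    {z : σ → R} (h : z a = z b) : eval z (rename (Equiv.swap a b) f) = eval z f := by
  have hz : z ∘ Equiv.swap a b = z := by
    funext i
    simp only [Function.comp_apply]
    rcases eq_or_ne i a with rfl | hia
    · rw [Equiv.swap_apply_left, h]
    · rcases eq_or_ne i b with rfl | hib
      · rw [Equiv.swap_apply_right, h]
      · rw [Equiv.swap_apply_of_ne_of_ne hia hib]
  rw [eval_rename, hz]

/-- **Borcea–Brändén–Liggett, Theorem 4.20** (polynomial form): if `f ∈ ℂ[z_1, …, z_n]` is multi-affine and stable,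
`τ = (a b)` is a transposition and `θ ∈ [0,1]`, then `θ f + (1 - θ) f ∘ τ` is stable ("we need to prove that
`θ f(ξ_1, ξ_2, …, ξ_n) + (1 - θ) f(ξ_2, ξ_1, …, ξ_n) ≠ 0` whenever `ξ_1, …, ξ_n ∈ {z : Im(z) > 0}`"). Proof:
Borcea–Brändén's symbol criterion (`multiAffine_stabilityPreserver_sufficiency`) with §2 gives "stable or `0`", and
`T_θ(f)(z) = f(z) ≠ 0` at any `z ∈ Hⁿ` with `z_a = z_b` excludes `0`.
[cite: BorceaBrandenLiggett2007, §4.3 Thm. 4.20] -/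
theorem IsUpperHalfPlaneStable.partialSymmetrization {f : MvPolynomial σ ℂ} (hf : IsMultiAffine f)
    (hs : IsUpperHalfPlaneStable f) (a b : σ) {θ : ℝ} (h0 : 0 ≤ θ) (h1 : θ ≤ 1) :
    IsUpperHalfPlaneStable ((θ : ℂ) • f + (1 - (θ : ℂ)) • MvPolynomial.rename (Equiv.swap a b) f) := by
  have h := multiAffine_stabilityPreserver_sufficiency
    (StablePolynomials.partialSymmetrization (θ : ℂ) (Equiv.swap a b))
    (isUpperHalfPlaneStable_multiAffineSymbol_partialSymmetrization h0 h1 a b) hf hs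
  rw [partialSymmetrization_apply] at h
  refine h.resolve_right fun h0' => ?_
  -- `T_θ(f)(i, …, i) = f(i, …, i) ≠ 0`
  have hval : eval (fun _ => Complex.I) ((θ : ℂ) • f + (1 - (θ : ℂ)) • MvPolynomial.rename (Equiv.swap a b) f) =
      eval (fun _ => Complex.I) f := by
    rw [map_add, smul_eval, smul_eval, eval_rename_swap_of_eq f (a := a) (b := b) (z := fun _ => Complex.I) rfl]
    ring
  rw [h0', map_zero] at hval
  exact hs (fun _ => Complex.I) (fun _ => by simp) hval.symm

/-- **Theorem 4.20 for real stable polynomials**: `θ f + (1 - θ) f ∘ (a b)` is real stable for a real stable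
multi-affine `f` and `θ ∈ [0,1]`. [cite: BorceaBrandenLiggett2007, §4.3 Thm. 4.20 ("In particular … the class of
strongly Rayleigh measures … is invariant under the partial symmetrization procedure")] -/
theorem IsRealStable.partialSymmetrization {f : MvPolynomial σ ℝ} (hf : IsMultiAffine f) (hs : IsRealStable f)
    (a b : σ) {θ : ℝ} (h0 : 0 ≤ θ) (h1 : θ ≤ 1) :
    IsRealStable (θ • f + (1 - θ) • MvPolynomial.rename (Equiv.swap a b) f) := by
  have h := IsUpperHalfPlaneStable.partialSymmetrization (isMultiAffine_map_algebraMap hf) hs a b h0 h1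
  rw [IsRealStable]
  convert h using 1
  rw [smul_eq_C_mul, smul_eq_C_mul, map_add, map_mul, map_mul, map_C, map_C, map_rename, smul_eq_C_mul,
    smul_eq_C_mul, Complex.coe_algebraMap, Complex.ofReal_sub, Complex.ofReal_one]

/-- **Brändén–Huh's form** ("if `f` is a stable multi-affine polynomial […], then
`Φ^{1,2}_θ(f) = (1 - θ) f(w_1, w_2, w_3, …, w_n) + θ f(w_2, w_1, w_3, …, w_n)` is stable for all `0 ≤ θ ≤ 1`";
here for any two variables `a, b`, and without the sign condition on the coefficients, which plays no role).
[cite: BrandenHuh2019, §3.1 (before Cor. 3.9, citing [BBL])] [cite: BorceaBrandenLiggett2007, §4.3 Thm. 4.20] -/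
theorem IsRealStable.symmExclusion {f : MvPolynomial σ ℝ} (hf : IsMultiAffine f) (hs : IsRealStable f)
    (a b : σ) {θ : ℝ} (h0 : 0 ≤ θ) (h1 : θ ≤ 1) :
    IsRealStable ((1 - θ) • f + θ • MvPolynomial.rename (Equiv.swap a b) f) := by
  have h := hs.partialSymmetrization hf a b (sub_nonneg.2 h1) (sub_le_self 1 h0)
  rwa [sub_sub_cancel] at h

end Main

end Literature.Combinatorics.StablePolynomials

end
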